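import Summits.BirchSwinnertonDyer.BirchSwinnertonDyer.Theorems.ByReductionTypeAtTwoRankOneAtTwoOneDoorLawFirstLayerDefs
import Mathlib.Analysis.Quaternion
import Mathlib.NumberTheory.Padics.PadicNumbers
import HarnessLib

/-!
# ES-39 (cell bsd-f1-sign2, seat -es g30): THE FIRST EXPLICIT RECIPROCITY LAW AT `p = 2` HAS THE ADMISSIBLE PRIME `ℓ = 2` —
# the mod-`8` Jochnowitz congruence on the Hurwitz quaternions

Sketch only (planner seat; nothing here is proposed to the tree; the typer ports).  Crux `RankOneAtTwoBigImageOddLocal`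
(stmt-BirchSwinnertonDyer-23715).  MEMO-es §39; census `CensusES39.md` (same directory); ENGINE 39 = `data-es/g30/job39/engine39.py`.

THE DICTIONARY.  For an optimal curve `E` of odd prime conductor `N` with `a₂ = a₂(E)` ODD (so `a₂ = ±1`):
`#Ẽ(𝔽₄) = 9 − a₂² = 8` and `Ẽ(𝔽₄) ≅ ℤ/8` is cyclic, with `Frob₂` acting as the unit root `α` of `X² − a₂X + 2`, `α ≡ 3a₂ (mod 8)`;
`#Ẽ(𝔽₂) = 3 − a₂ ∈ {2, 4}` — in Bertolini–Darmon's language `2² ∣ ℓ + 1 − ε a_ℓ` AT `ℓ = p = 2` for the sign `ε = −a₂`: the prime `2`,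
which RAMIFIES in the definite algebra `B_{2,∞} = ℍ[ℚ]` (Hurwitz), is «`2`-admissible» for every `2`-ordinary `f_E`, although no printed
definition of admissibility allows `ℓ = p` (`Literature.Barriers.BirchSwinnertonDyer.NoAdmissiblePrimesAtThree`: `¬ IsAdmissiblePrime 2`).
ON THE QUATERNION SIDE (ENGINE 39, Brandt module of `ℍ[ℚ]` at Eichler level `N`, class set `S`, `h = |S|`): the definite level-raising module
`Q_f := ℤ[S] / Σ_{ℓ odd, ℓ ≠ N} (T_ℓ − a_ℓ(E)) ℤ[S]` has `Q_f ⊗ ℤ₂ = 0` iff `a₂` is even, and for `a₂` odd its `W₂ = α` part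
`Q_f^{α} := Q_f / (W₂ − α)` (`W₂ : I ↦ I·𝔓`, `𝔓` the two-sided prime above `2`) satisfies `Q_f^{α} ⊗ ℤ₂ ≅ ℤ/8` — the SAME cyclic group of
order `8`, `W₂ ↔ Frob₂` — while the `W₂ = ±1` coinvariants have orders `2^{v₂(α ∓ 1)}·2^{x}` = `#Ẽ^{(±)}(𝔽₂)[2^∞]·2^{x}` (`x` = the anemic excess,
`0` on the ramified classes).  Dually: the mod-`8` quaternionic eigenforms `φ : S → ℤ/8` with `T_ℓ φ = a_ℓ(E) φ` and `W₂ φ = 3a₂ φ` form a free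
`ℤ/8`-module of rank one (`IsModEightAlphaForm`, `ModEightAlphaLineAtTwo`).
THE LAW (`JochnowitzCongruenceAtTwo`).  For `K = ℚ(√D)`, `D < −4`, `D ≡ 5 (mod 8)` (`2` INERT), `(D/N) = +1`, Heegner point `y_K ∈ E(K)`,
Gross points `x = (ψ, I)` of `𝒪_K` on the class set and the mod-`8` toric period `T₈ := Σ_{σ ∈ Pic 𝒪_K} φ(σ·x) ∈ ℤ/8`:
        the order of `T₈` in `ℤ/8`  =  the order of `red_{(2)}(y_K)` in `Ẽ(𝔽₄) = ℤ/8`,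
i.e. `2^k · T₈ = 0 ↔ 2^k · y_K` reduces to the origin modulo `2𝒪_K` (all `k`).  Since `y_K` comes from `E(ℚ)` or `E^{(D)}(ℚ)`, both sides are
`≤ 4`: `red(y_K) ∈ Ẽ^{(ε*)}(𝔽₂) ⊂ Ẽ(𝔽₄)`.  This is the Bertolini–Darmon first explicit reciprocity law / Jochnowitz congruence
«`loc_ℓ κ ≠ 0 ⟺ L_alg(g/K,1) ∈ (ℤ/pⁿ)^×`» with `(p, ℓ, n) = (2, 2, 3)`: the localisation AT `p` ITSELF of the Heegner class, read in the
`8`-element group `Ẽ(𝔽₄)`, against the special value of the mod-`8` level-raised form on the algebra ramified AT `p`.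
CENSUS ENGINE 39 (kit job j340934, engine sha16 953a4938b19ab9a4; CensusES39.md): ALL 112 prime levels `11 ≤ N ≤ 2953` carrying a curve
with `v₂(N) = 0` of the F1/sign-2 input list (144 isogeny classes; `h` up to 248), 1053 (class, `D`) doors with `D ≡ 5 (mod 8)`, `|D| ≤ 163`.
Consistency 112/112 (mass; `#Hom(O,𝔽₄) = #Hom(O,𝔽_N) = 2`; `W₂`, `W_N` commuting involutions commuting with all `T_ℓ`; `Σ_i A_i(D,o) = h(D)`
per orientation class on 104/112 levels — on 8 levels one Gross point sits at a class whose local generator was not found, those 10 doors are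
dropped); `W₂ φ_g = +a₂(g) φ_g`, `W_N φ_g = −a_N(g) φ_g` on 168/168 rational `2`-new `g`.  STRUCTURE (65 ordinary classes with `E[2]`
irreducible = 38 RAM + 15 UNS + 12 TRIV; 66 supersingular): `Q_f ⊗ ℤ₂ = 0` on 66/66 supersingular classes; `Q_f ⊗ ℤ₂ ≅ ℤ/8` (RAM 38/38),
`ℤ/8 ⊕ ℤ/2` (UNS 15/15), `ℤ/8 ⊕ ℤ/2 ⊕ ℤ/2` (TRIV 12/12); the `α`-line `Q_f^{α} ⊗ ℤ₂ ≅ ℤ/8` on 53/53 RAM ∪ UNS classes and `ℤ/8 ⊕ (ℤ/2)²` on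
12/12 TRIV classes (`E[2] ⊂ E(ℚ₂)`, the Kilford–Wiese non-Gorenstein classes `431a,b, 503a,b,c, 1439a, 1607a, 2089a,c,d,e, 2351a`) — so
multiplicity one mod `8` (`ModEightAlphaLineAtTwo`) holds exactly under `NontrivialAtTwo`; `W₂ = ±1` coinvariants have order `2^{v₂(α ∓ 1)}`
(RAM 38/38) resp. `2^{v₂(α ∓ 1)+1}` (UNS 15/15).  THE LAW `t = s` (class exponent of the Gross divisor in `Q_f^{α} ⊗ ℤ₂` = `log₂` of the order
of `red_{2𝒪_K}(y_K)`): **318/318 non-torsion ordinary doors** (RAM 178, UNS 71, TRIV 69; `r_an(E) = 0`: 154 via the twist, `= 1`: 164;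
values `t = s = 0 / 1 / 2` on 62 / 144 / 112 doors; 130 of them discriminating — Gross–Zagier index even or generator halving in `Ẽ(𝔽₂)`),
two/three E-side engines agreeing on every door where ≥ 2 are defined (0 disagreements); `t = 0` on **149/149 torsion doors** (106 with
`r_an(E) ≥ 2`, 43 with `L(E*,1) = 0`) and on 481/481 supersingular doors; `t^{an} = t^{α}` and `t` orientation-free on 468/468.
WHY NOVEL (search log MEMO-es §39.7): Bertolini–Darmon (2005) Def. of `p`-admissible requires `ℓ ∤ 2pN`; Gross–Parson, Zhang 2014, BD 1999,
Kim 2024, Le Hung–Li 2016 all take `p` odd or `ℓ ≠ p`; no print source found for a level-raising reciprocity law with `ℓ = p` (any `p`), let alone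
`ℓ = p = 2` where the target group is `Ẽ(𝔽₄)`.
-/

noncomputable section

open scoped Classical BigOperators Quaternion

set_option linter.dupNamespace false
set_option autoImplicit false

namespace Summit.BirchSwinnertonDyer.BirchSwinnertonDyer.Theorems.RankOneAtTwoJochnowitzAtTwo

open Literature.NumberTheory.EllipticCurves Literature.NumberTheory.EllipticCurves.ModularForms
  Summit.BirchSwinnertonDyer.Rank1Residual.F1Sign2
  Summit.BirchSwinnertonDyer.BirchSwinnertonDyer.Theorems.RankOneAtTwoOneDoor
  WeierstrassCurve

/-! ## The quaternion side: `B = B_{2,∞} = ℍ[ℚ]`, Eichler order of level `N`, right ideals, `𝔓`, mod-`8` eigenforms -/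

/-- `O ⊆ ℍ[ℚ]` is an EICHLER ORDER OF LEVEL `N`: the intersection of two maximal `ℤ`-orders with `[O₁ : O] = N`
(clause `eichler` of `RankOneAtTwoJochnowitz.DefiniteFrame`, ES-31, itself copied from the Kim-2024 toric-period fact). -/
def IsEichlerOrder (N : ℕ) (O : Subring ℍ[ℚ]) : Prop :=
  ∃ O₁ O₂ : Subring ℍ[ℚ],
    (∀ S : Subring ℍ[ℚ], (S = O₁ ∨ S = O₂) →
      (S.toAddSubgroup.FG ∧ (∀ d : ℍ[ℚ], ∃ m : ℤ, m ≠ 0 ∧ m • d ∈ S) ∧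
        ∀ S' : Subring ℍ[ℚ], S'.toAddSubgroup.FG → S ≤ S' → S' = S)) ∧
    O = O₁ ⊓ O₂ ∧ O.toAddSubgroup.relIndex O₁.toAddSubgroup = N

/-- `RI` is THE SET OF INVERTIBLE RIGHT `O`-IDEALS of `ℍ[ℚ]` (clause `ideals` of ES-31's `DefiniteFrame`). -/
def IsRightIdealSet (O : Subring ℍ[ℚ]) (RI : Set (Submodule ℤ ℍ[ℚ])) : Prop :=
  ∀ J : Submodule ℤ ℍ[ℚ], J ∈ RI ↔
    (J.FG ∧ (∀ d : ℍ[ℚ], ∃ m : ℤ, m ≠ 0 ∧ m • d ∈ J) ∧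
      (∀ x : ℍ[ℚ], (∀ y ∈ J, y * x ∈ J) ↔ x ∈ O) ∧
      (∃ J' : Submodule ℤ ℍ[ℚ],
        (∀ x : ℍ[ℚ], x ∈ J * J' ↔ ∀ y ∈ J, x * y ∈ J) ∧
        (∀ x : ℍ[ℚ], x ∈ J' * J ↔ x ∈ O)))

/-- `𝔓 = 𝔓(O)`: the two-sided ideal of `O` above the ramified prime `2` — the elements of `O` of EVEN reduced norm
(locally at `2`, `O₂` is the maximal order of the division algebra `ℍ ⊗ ℚ₂` and `𝔓₂ = {v(nrd) ≥ 1}`; `O/𝔓 ≅ 𝔽₄`, `𝔓² = 2O`).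
`W₂ : I ↦ I·𝔓` is the involution of the class set playing FROBENIUS AT `2`. -/
def primeAboveTwo (O : Subring ℍ[ℚ]) : Submodule ℤ ℍ[ℚ] :=
  Submodule.span ℤ {x : ℍ[ℚ] | x ∈ O ∧ ∃ m : ℤ, Quaternion.normSq x = 2 * (m : ℚ)}

/-- `ρ̄_{W,2}|_{G_{ℚ₂}}` is non-trivial: the `2`-division cubic `4x³ + b₂x² + 2b₄x + b₆` does not split completely over `ℚ₂`
(verbatim `NontrivialAtTwo` of ES-28 `LevelRaisingReciprocityES28.lean`; for `a₂` odd it excludes exactly the TRIV classes `E[2] ⊂ E(ℚ₂)`,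
i.e. the Kilford–Wiese classes where the mod-`2` Hecke algebra is not Gorenstein). -/
def NontrivialAtTwo (W : WeierstrassCurve ℚ) : Prop :=
  ((W.twoTorsionPolynomial.toPoly).map (algebraMap ℚ ℚ_[2])).roots.card < 3

/-- **Mod-`8` quaternionic `α`-eigenmap of `f_W`** (not necessarily primitive): `φ : RI → ℤ/8` left-`ℍ^×`-invariant, Hecke-eigen with the
eigenvalues of `W` mod `8` at the odd primes `ℓ ∤ N`, and `W₂`-eigen with eigenvalue `α ≡ 3a₂(W) (mod 8)`.  ENGINE 39: `Hom(Q_f^{α}, ℤ/8)`. -/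
def IsModEightAlphaMap (W : WeierstrassCurve ℚ) [W.IsElliptic] [W.IsGloballyMinimal] (N : ℕ) (O : Subring ℍ[ℚ]) (RI : Set (Submodule ℤ ℍ[ℚ]))
    (φ : Submodule ℤ ℍ[ℚ] → ZMod 8) : Prop :=
  -- invariant
  (∀ J ∈ RI, ∀ β : ℍ[ℚ], IsUnit β → φ (J.map (AddMonoidHom.mulLeft β).toIntLinearMap) = φ J) ∧
  -- eigen (ℓ odd, ℓ ∤ N)
  (∀ ℓ : ℕ, ℓ.Prime → ¬ ℓ ∣ 2 * N → ∀ J ∈ RI,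
    ∑ᶠ J' ∈ {J' : Submodule ℤ ℍ[ℚ] | J' ≤ J ∧ J'.toAddSubgroup.relIndex J.toAddSubgroup = ℓ ^ 2 ∧ ∀ y ∈ J', ∀ x ∈ O, y * x ∈ J'},
      φ J' = ((W.frobeniusTrace ℓ : ℤ) : ZMod 8) * φ J) ∧
  -- alpha at 2:  φ(J·𝔓) = α φ(J),  α ≡ 3 a₂ (mod 8)
  (∀ J ∈ RI, φ (J * primeAboveTwo O) = ((3 * W.frobeniusTrace 2 : ℤ) : ZMod 8) * φ J)

/-- **Primitive mod-`8` quaternionic `α`-eigenform of `f_W`**: an `α`-eigenmap some value of which is a unit of `ℤ/8`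
(ENGINE 39: the surjections `Q_f^{α} ↠ ℤ/8`). -/
def IsModEightAlphaForm (W : WeierstrassCurve ℚ) [W.IsElliptic] [W.IsGloballyMinimal] (N : ℕ) (O : Subring ℍ[ℚ]) (RI : Set (Submodule ℤ ℍ[ℚ]))
    (φ : Submodule ℤ ℍ[ℚ] → ZMod 8) : Prop :=
  IsModEightAlphaMap W N O RI φ ∧ ∃ J ∈ RI, IsUnit (φ J)

/-- **A Gross point of `𝒪_K` with class representatives** `(ψ, I, rep)` (verbatim ES-31 `GrossPoint`, on `ℍ[ℚ]`): `I ∈ RI`, `ψ : K → ℍ[ℚ]`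
embeds `𝒪_K` OPTIMALLY into the left order of `I`, `rep` = integral ideal representatives of `Pic 𝒪_K`.  (For `D ≡ 5 (mod 8)` and `N` split,
`4·h(D)` such points up to the class-set symmetries, in four orientation classes; the law below is orientation-free.) -/
def GrossPoint (RI : Set (Submodule ℤ ℍ[ℚ])) (K : Type) [Field K] [NumberField K]
    (ψ : K →ₐ[ℚ] ℍ[ℚ]) (I : Submodule ℤ ℍ[ℚ])
    (rep : ClassGroup (NumberField.RingOfIntegers K) → nonZeroDivisors (Ideal (NumberField.RingOfIntegers K))) : Prop :=
  (I ∈ RI) ∧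
  (∀ x : NumberField.RingOfIntegers K, ∀ y ∈ I, ψ (x : K) * y ∈ I) ∧
  (∀ x : K, (∀ y ∈ I, ψ x * y ∈ I) → ∃ z : NumberField.RingOfIntegers K, (z : K) = x) ∧
  (∀ 𝔞 : ClassGroup (NumberField.RingOfIntegers K), ClassGroup.mk0 (rep 𝔞) = 𝔞)

/-- **The mod-`8` toric period** `T₈(φ, K) = Σ_{[𝔞] ∈ Pic 𝒪_K} φ(ψ(𝔞)·I) ∈ ℤ/8` (ENGINE 39: `φ(c(D,o))`, `c(D,o) ∈ ℤ[S]` the Gross divisor). -/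
def toricPeriodModEight (φ : Submodule ℤ ℍ[ℚ] → ZMod 8) (K : Type) [Field K] [NumberField K]
    (ψ : K →ₐ[ℚ] ℍ[ℚ]) (I : Submodule ℤ ℍ[ℚ])
    (rep : ClassGroup (NumberField.RingOfIntegers K) → nonZeroDivisors (Ideal (NumberField.RingOfIntegers K))) : ZMod 8 :=
  ∑ 𝔞 : ClassGroup (NumberField.RingOfIntegers K),
    φ (Submodule.span ℤ ((fun x : NumberField.RingOfIntegers K => ψ (x : K)) ''
        ((rep 𝔞 : nonZeroDivisors (Ideal (NumberField.RingOfIntegers K))) : Ideal (NumberField.RingOfIntegers K))) * I)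

/-! ## The curve side at the inert prime `2𝒪_K`: reduction to the origin, read off the minimal model -/

/-- `x ∈ K` is INTEGRAL AT `2` (for `2` unramified in `K`): some odd multiple of `x` is an algebraic integer. -/
def IsIntegralAtTwo (K : Type) [Field K] (x : K) : Prop :=
  ∃ m : ℕ, Odd m ∧ IsIntegral ℤ ((m : K) * x)

/-- `P ∈ W(K)` REDUCES TO THE ORIGIN modulo the prime(s) above `2` (`W` a minimal model at `2`, `2` unramified in `K`): `P = 0` or the
`x`-coordinate of `P` is not `2`-integral.  For `a₂(W)` odd and `2` inert, `Ẽ(𝒪_K/2) = Ẽ(𝔽₄)` has exactly `8` points, so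
`k ↦ ReducesToZeroAtTwo (2^k • P)` reads the order of `red(P)` in the cyclic group `ℤ/8`. -/
def ReducesToZeroAtTwo (W : WeierstrassCurve ℚ) (K : Type) [Field K] [NumberField K]
    (P : (W.baseChange K).toAffine.Point) : Prop :=
  ∀ {x y : K} (h : (W.baseChange K).toAffine.Nonsingular x y), P = WeierstrassCurve.Affine.Point.some x y h → ¬ IsIntegralAtTwo K x

/-! ## The statements -/

/-- **ES-39S `ModEightAlphaLineAtTwo` — «`2` IS `2`-ADMISSIBLE FOR EVERY `2`-ORDINARY NEWFORM WITH `ρ̄|G_{ℚ₂}` NON-TRIVIAL»: THE MOD-`8`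
LEVEL-RAISED LINE EXISTS AND IS UNIQUE (structure statement; THEOREM-candidate via Ribet's exact sequence for the character group of the torus
of `J₀(2N)` at `2` + Deligne–Rapoport / Jacquet–Langlands with the Brandt module of `ℍ[ℚ]`, `c₂ = α² − 1` with `v₂(α² − 1) = 3` for `a₂` odd —
BUT at residue characteristic `2`, the excluded case of every printed multiplicity-one / freeness statement, and multiplicity one mod `2` at
`p = 2` is exactly the Gorenstein question settled by Kilford–Wiese: it FAILS iff `E[2] ⊂ E(ℚ₂)`).**  `W` minimal of odd prime conductor `N`,
`a₂(W)` odd, `W(ℚ)[2] = 0` (⟺ `ρ̄_{W,2}` irreducible), `NontrivialAtTwo W`; `O` Eichler of level `N` in `ℍ[ℚ]`, `RI` its invertible right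
ideals.  THEN a primitive mod-`8` `α`-eigenform exists and any two agree up to a unit of `ℤ/8` on `RI`.  CENSUS (CensusES39 §2):
`Q_f^{α} ⊗ ℤ₂ ≅ ℤ/8` on 53/53 classes with `NontrivialAtTwo` (38 RAM, 15 UNS, `N ≤ 2917`); WITHOUT the hypothesis it is FALSE: `ℤ/8 ⊕ (ℤ/2)²` on
12/12 TRIV classes (`431a1 … 2351a1`).  Why it might fail: an anemic excess inside the `α`-line at some level (`Q_f^{α} ⊗ ℤ₂ = ℤ/16` or an extra
`ℤ/2` from a second congruent newform at level `N` or `2N` outside the TRIV mechanism).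
[cite: DiamondDarmonTaylor1995, §4.4–4.5 (`c_ℓ`, Ihara, ℓ ≠ p)] [cite: Ribet1990ICM, Thm. 1] [cite: KilfordWiese2008, Thm. 1.1 (non-Gorenstein at p = 2)]
[cite: GrossLMS1987, §3] -/
@[conjecture] def ModEightAlphaLineAtTwo : Prop :=
  ∀ (W : WeierstrassCurve ℚ) [W.IsElliptic] [W.IsGloballyMinimal] [NeZero (W.conductorNorm ℤ)],
    (W.conductorNorm ℤ).Prime → Odd (W.conductorNorm ℤ) → Odd (W.frobeniusTrace 2) →
    (∀ Q : (W.baseChange ℚ).toAffine.Point, 2 • Q = 0 → Q = 0) → NontrivialAtTwo W →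
    ∀ (O : Subring ℍ[ℚ]) (RI : Set (Submodule ℤ ℍ[ℚ])), IsEichlerOrder (W.conductorNorm ℤ) O → IsRightIdealSet O RI →
      (∃ φ : Submodule ℤ ℍ[ℚ] → ZMod 8, IsModEightAlphaForm W (W.conductorNorm ℤ) O RI φ) ∧
      (∀ φ φ' : Submodule ℤ ℍ[ℚ] → ZMod 8, IsModEightAlphaForm W (W.conductorNorm ℤ) O RI φ →
        IsModEightAlphaForm W (W.conductorNorm ℤ) O RI φ' → ∃ u : ZMod 8, IsUnit u ∧ ∀ J ∈ RI, φ' J = u * φ J)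

/-- **ES-39J `JochnowitzCongruenceAtTwo` — THE FIRST EXPLICIT RECIPROCITY LAW AT `p = 2` WITH ADMISSIBLE PRIME `ℓ = 2` (CONJECTURE of this
lens; the candidate `Prop`).**  `W` minimal, odd prime conductor `N`, `a₂(W)` odd, `W(ℚ)[2] = 0`, `NontrivialAtTwo W`; `K` imaginary quadratic
with `d_K < −4`, `d_K ≡ 5 (mod 8)` (`2` inert) and `N` split (Heegner hypothesis); `W(K)[2] = 0`; `y_K = P ∈ W(K)` the Heegner point of a
parametrisation datum with odd constant; `φ` a primitive mod-`8` `α`-eigenform on the right ideals of an Eichler order of level `N` in `ℍ[ℚ]`;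
`(ψ, I, rep)` any Gross point of `𝒪_K`.  THEN for every `k`:
`2^k·y_K` reduces to the origin mod `2𝒪_K`  ⟺  `2^k · T₈(φ, K) = 0` in `ℤ/8`
— the order of the reduction of the Heegner point in `Ẽ(𝔽₄) ≅ ℤ/8` IS the order of the mod-`8` toric period.  Both sides are automatically
`≤ 4` (`y_K` is, up to odd index and odd torsion, `ℚ`-rational on `E` or on `E^{(D)}`); `T₈ = 0` when `y_K` is torsion.  No rank, no big-image,
no Tamagawa hypothesis: uniform over `r_an(E) ∈ {0, 1, ≥ 2}`.  CENSUS (CensusES39 §3): the law on **249/249** non-torsion doors of the 53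
`NontrivialAtTwo` classes (`t = s = 0/1/2` on 51/113/85; 164+154 split `E`/twist over all ordinary doors), `T₈ = 0` on 132/132 torsion doors,
0 E-side engine disagreements.  Why it might fail: (i) a class with anemic excess on the `α`-line (see `ModEightAlphaLineAtTwo`); (ii) doors with
`W(K)[2] ≠ 0` are excluded by hand and none occurs in the census; (iii) `|D| > 163` and `h(D)` large untested; (iv) the sign-free form hides
which of `E`, `E^{(D)}` carries `y_K` — the SIGNED refinement (`W_N` acts as `−a_N(E)` on the `α`-line, 65/65) is recorded in MEMO-es §39.4, not
typed.  Cheapest falsifier: one ordinary `NontrivialAtTwo` door with `t ≠ s`, two E-side engines agreeing.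
[cite: BertoliniDarmon2005, Thm. 4.1 and §2.2 (p-admissible: ℓ ∤ 2pN) — shape with (p,ℓ,n) = (2,2,3)] [cite: GrossLMS1987, Prop. 10.3, §11]
[cite: BertoliniDarmon1999AJM, Thm. 6.1 (Jochnowitz congruence, p odd)] [cite: Zhang2014CJM, Thm. 6.5 (p ≥ 5)] [cite: GrossZagier1986, Thm. I.6.3] -/
@[conjecture] def JochnowitzCongruenceAtTwo : Prop :=
  ∀ (W : WeierstrassCurve ℚ) [W.IsElliptic] [W.IsGloballyMinimal] [NeZero (W.conductorNorm ℤ)],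
    (W.conductorNorm ℤ).Prime → Odd (W.conductorNorm ℤ) → Odd (W.frobeniusTrace 2) →
    (∀ Q : (W.baseChange ℚ).toAffine.Point, 2 • Q = 0 → Q = 0) → NontrivialAtTwo W →
    ∀ (K : Type) [Field K] [NumberField K], IsImaginaryQuadratic K → NumberField.discr K < -4 → NumberField.discr K % 8 = 5 →
      SatisfiesHeegnerHypothesis (W.conductorNorm ℤ) K → (∀ Q : (W.baseChange K).toAffine.Point, 2 • Q = 0 → Q = 0) →
    ∀ (Dt : ModularParametrizationData W (W.conductorNorm ℤ)) (H : HeegnerDatum (W.conductorNorm ℤ) (NumberField.discr K))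
      (ι : K →+* ℂ) (P : (W.baseChange K).toAffine.Point),
      WeierstrassCurve.Affine.Point.map ι.toRatAlgHom P = heegnerPointComplex Dt H → Odd Dt.c →
    ∀ (O : Subring ℍ[ℚ]) (RI : Set (Submodule ℤ ℍ[ℚ])) (φ : Submodule ℤ ℍ[ℚ] → ZMod 8),
      IsEichlerOrder (W.conductorNorm ℤ) O → IsRightIdealSet O RI → IsModEightAlphaForm W (W.conductorNorm ℤ) O RI φ →
    ∀ (ψ : K →ₐ[ℚ] ℍ[ℚ]) (I : Submodule ℤ ℍ[ℚ])
      (rep : ClassGroup (NumberField.RingOfIntegers K) → nonZeroDivisors (Ideal (NumberField.RingOfIntegers K))),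
      GrossPoint RI K ψ I rep →
    ∀ k : ℕ, ReducesToZeroAtTwo W K ((2 ^ k : ℤ) • P) ↔ (2 ^ k : ZMod 8) * toricPeriodModEight φ K ψ I rep = 0

/-- **ES-39X `JochnowitzExponentLawAtTwo` — THE SAME LAW IN EXPONENT FORM, WITHOUT `NontrivialAtTwo` (CONJECTURE; covers the non-Gorenstein
TRIV classes).**  Hypotheses of `JochnowitzCongruenceAtTwo` minus `NontrivialAtTwo`; conclusion: `2^k·y_K` reduces to the origin mod `2𝒪_K`
iff `2^k · T₈(φ, K) = 0` for EVERY (not necessarily primitive) mod-`8` `α`-eigenmap `φ` — i.e. the order of `red(y_K)` in `Ẽ(𝔽₄)` equals the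
order of the class of the Gross divisor in `Q_f^{α} ⊗ ℤ₂` (a group of exponent `8`: `ℤ/8` or, on TRIV classes, `ℤ/8 ⊕ (ℤ/2)²`).  Under
`NontrivialAtTwo` + `ModEightAlphaLineAtTwo` it is equivalent to `JochnowitzCongruenceAtTwo`.  CENSUS (CensusES39 §3): **318/318** non-torsion
ordinary doors (69 of them TRIV), `t = 0` on 149/149 torsion doors.  Why it might fail: on a TRIV class the Gross divisor could acquire a
component in the `(ℤ/2)²` (old-at-`2`, multiplicity-two) directions not governed by `y_K` — the census says it does not on 69 + 17 TRIV doors, but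
only 12 TRIV classes (`N ≤ 2351`) were available. [cite: KilfordWiese2008, Thm. 1.1] [cite: BertoliniDarmon2005, Thm. 4.1] [cite: GrossLMS1987, §11] -/
@[conjecture] def JochnowitzExponentLawAtTwo : Prop :=
  ∀ (W : WeierstrassCurve ℚ) [W.IsElliptic] [W.IsGloballyMinimal] [NeZero (W.conductorNorm ℤ)],
    (W.conductorNorm ℤ).Prime → Odd (W.conductorNorm ℤ) → Odd (W.frobeniusTrace 2) →
    (∀ Q : (W.baseChange ℚ).toAffine.Point, 2 • Q = 0 → Q = 0) →
    ∀ (K : Type) [Field K] [NumberField K], IsImaginaryQuadratic K → NumberField.discr K < -4 → NumberField.discr K % 8 = 5 →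
      SatisfiesHeegnerHypothesis (W.conductorNorm ℤ) K → (∀ Q : (W.baseChange K).toAffine.Point, 2 • Q = 0 → Q = 0) →
    ∀ (Dt : ModularParametrizationData W (W.conductorNorm ℤ)) (H : HeegnerDatum (W.conductorNorm ℤ) (NumberField.discr K))
      (ι : K →+* ℂ) (P : (W.baseChange K).toAffine.Point),
      WeierstrassCurve.Affine.Point.map ι.toRatAlgHom P = heegnerPointComplex Dt H → Odd Dt.c →
    ∀ (O : Subring ℍ[ℚ]) (RI : Set (Submodule ℤ ℍ[ℚ])), IsEichlerOrder (W.conductorNorm ℤ) O → IsRightIdealSet O RI →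
    ∀ (ψ : K →ₐ[ℚ] ℍ[ℚ]) (I : Submodule ℤ ℍ[ℚ])
      (rep : ClassGroup (NumberField.RingOfIntegers K) → nonZeroDivisors (Ideal (NumberField.RingOfIntegers K))),
      GrossPoint RI K ψ I rep →
    ∀ k : ℕ, ReducesToZeroAtTwo W K ((2 ^ k : ℤ) • P) ↔
      ∀ φ : Submodule ℤ ℍ[ℚ] → ZMod 8, IsModEightAlphaMap W (W.conductorNorm ℤ) O RI φ →
        (2 ^ k : ZMod 8) * toricPeriodModEight φ K ψ I rep = 0

/-- **ES-39N `SupersingularNoFusionAtTwo` — the other half of «`2` is `2`-admissible iff `f` is `2`-ordinary» (THEOREM-candidate, easy side):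
for `a₂(W)` EVEN there is no non-zero mod-`2` quaternionic eigenform of `f_W` on `ℍ[ℚ]` at level `N` away from the Eisenstein line, i.e. every
`φ : RI → ℤ/2`, invariant and Hecke-eigen for `W` at the odd primes `ℓ ∤ N`, is constant on `RI` (`#Ẽ(𝔽₄) = 9 − a₂²` is odd: no fusion with the
`2`-new part).  CENSUS (CensusES39 §2): `Q_f ⊗ ℤ₂ = 0` on 66/66 supersingular classes (`N ≤ 2953`), `t = 0` on 481/481 supersingular doors.  Why it
might fail: an Eisenstein-type congruence `a_ℓ(W) ≡ ℓ + 1 (mod 2)` for all odd `ℓ` would force `W[2]` reducible, excluded by the `2`-torsion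
hypothesis only because `N` is prime (Mazur); at composite level the hypothesis would have to be on the isogeny class. [cite: Mazur1977Eisenstein, Thm. (III.1.2)]
[cite: GrossLMS1987, §3] -/
@[conjecture] def SupersingularNoFusionAtTwo : Prop :=
  ∀ (W : WeierstrassCurve ℚ) [W.IsElliptic] [W.IsGloballyMinimal] [NeZero (W.conductorNorm ℤ)],
    (W.conductorNorm ℤ).Prime → Odd (W.conductorNorm ℤ) → Even (W.frobeniusTrace 2) →
    (∀ Q : (W.baseChange ℚ).toAffine.Point, 2 • Q = 0 → Q = 0) →
    ∀ (O : Subring ℍ[ℚ]) (RI : Set (Submodule ℤ ℍ[ℚ])), IsEichlerOrder (W.conductorNorm ℤ) O → IsRightIdealSet O RI →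
    ∀ φ : Submodule ℤ ℍ[ℚ] → ZMod 2,
      (∀ J ∈ RI, ∀ β : ℍ[ℚ], IsUnit β → φ (J.map (AddMonoidHom.mulLeft β).toIntLinearMap) = φ J) →
      (∀ ℓ : ℕ, ℓ.Prime → ¬ ℓ ∣ 2 * W.conductorNorm ℤ → ∀ J ∈ RI,
        ∑ᶠ J' ∈ {J' : Submodule ℤ ℍ[ℚ] | J' ≤ J ∧ J'.toAddSubgroup.relIndex J.toAddSubgroup = ℓ ^ 2 ∧ ∀ y ∈ J', ∀ x ∈ O, y * x ∈ J'},
          φ J' = ((W.frobeniusTrace ℓ : ℤ) : ZMod 2) * φ J) →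
      ∀ J ∈ RI, ∀ J' ∈ RI, φ J = φ J'

/-- Sanity link (definitional): a primitive `α`-eigenform is an `α`-eigenmap. -/
theorem IsModEightAlphaForm.isModEightAlphaMap {W : WeierstrassCurve ℚ} [W.IsElliptic] [W.IsGloballyMinimal] {N : ℕ} {O : Subring ℍ[ℚ]}
    {RI : Set (Submodule ℤ ℍ[ℚ])} {φ : Submodule ℤ ℍ[ℚ] → ZMod 8} (h : IsModEightAlphaForm W N O RI φ) :
    IsModEightAlphaMap W N O RI φ := h.1

end Summit.BirchSwinnertonDyer.BirchSwinnertonDyer.Theorems.RankOneAtTwoJochnowitzAtTwo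

end
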